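import Literature.Analysis.FluidPDE.PassiveVectorTensorPropagatorWeightedDecayAdjoint
import Literature.Analysis.FunctionSpaces.TorusDissipationWeightKernel
import Literature.Analysis.SpecialFunctions.DissipationProfile
import HarnessLib

/-!
# THE WINDOW DISSIPATION FLOOR: `‖U(s,s′)y‖², ‖U(s,s′)†y‖² ≤ ‖y‖² − ½ Σ_k min(1, 8π²·lo·|k|²·(s′−s))·|ŷ(k)|²` when `Lip(b)·(s′−s) ≤ c₀(d)`

Analysis/FluidPDE file (pure proof layer; no definitions, no named facts).  The weight bookkeeping of the two-weight method is discharged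
once and for all: with the profile `Ψ = Real.dissipProfile` (`0 ≤ Ψ ≤ (1−x)₊`, corridor `log 2·(1−Ψ x) ≤ (4/5)x`), the weight
`ω_k = Ψ(ε²|k|²)`, `ε² = 8π²·lo·(s′−s)`, on `F = freqBall ⌈1/ε⌉`, and the kernel third-moment bound `M₃ ≤ C(d)·ε²`
(`Torus.exists_cube_moment_fluxKernelGrad_le`, `ε ≤ 1`; for `ε > 1` the kernel vanishes identically), the flux condition
`Lip(b)·M₃ ≤ (4/5)·lo` of `IsPropagator.norm_sq_apply_le_sub_tsum` becomes the SCALE-FREE window condition `Lip(b)·(s′−s) ≤ c₀`,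
`c₀ = 1/(10π²(C+1))`:
* `fluxKernelGrad_dissipProfile_eq_zero_of_one_lt` — for `ε > 1` the dissipation-scale flux kernel is `0`;
* `exists_window_dissipation_const` — **∃ c₀(d) > 0** such that for every `IsPropagator T b 𝔸 U` (tensor `NearIso 𝔸 lo hi`, `lo > 0`;
  carrier `L^∞`, a.e. weakly divergence free, a.e. continuous, a.e. `L`-Lipschitz slices) and every window `0 ≤ s < s′ ≤ T` with
  `L·(s′−s) ≤ c₀`: for all `y ∈ L²`, BOTH `‖U s s′ y‖²` and `‖(U s s′)† y‖²` are
  `≤ ‖y‖² − ½ Σ'_k min(1, 8π²·lo·|k|²·(s′−s))·|ŷ(k)|²`.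

Consumer: cell `ad-ideate`, K1L_D `stmt-AnomalousDissipation-27980`, W3-E `stub_effectiveFrameEnergyL` clause (i): with `b = E.partialSum m`
(`Lip ≤ CL·Σa`, `…LagrangianStepPartialSumLipschitz`), `lo_eff = kbar m·lo`, the window condition is `2·CL·θ(m+1) ≤ c₀`, i.e. the strain
ceiling `θ₁ := min θs (c₀/(2CL))` (crux memo `Lines/onelevel-W3E-k3l-lyapunov.md` §6, P4e).

## Mathlib / tree search
Tree: `IsPropagator.norm_sq_apply_le_sub_tsum` (p680241), `IsPropagator.norm_sq_adjoint_apply_le_sub_tsum` (p680642),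
`Torus.exists_cube_moment_fluxKernelGrad_le`, `Torus.dissipWeight_eq_zero_of_not_mem_freqBall` (p678927), `Real.dissipProfile_*` (p678510),
`Torus.fluxKernelGrad` (p674891), `one_le_freqNormSq_of_ne_zero` / `freqNormSq_pos_of_ne_zero`.

## References
* R. Temam, *Navier–Stokes Equations* (1984), Ch. III §1 Lemma 1.2. [`Temam1984`]
* J. Bedrossian, M. Coti Zelati, Arch. Ration. Mech. Anal. 224 (2017), §2. [`BedrossianCotiZelati2017`]
-/

noncomputable section

open MeasureTheory Set Filter Function TopologicalSpace UnitAddTorus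
open scoped NNReal InnerProductSpace Topology

namespace Literature.Analysis.FluidPDE

namespace Torus

variable {d : Type*} [Fintype d] [DecidableEq d]

/-- **For `ε > 1` the dissipation-scale flux kernel vanishes**: on `freqBall ⌈1/ε⌉ = freqBall 1` the weight `Ψ(ε²|k|²)` kills every
`k ≠ 0` and the factor `k_a` kills `k = 0`. [cite: BedrossianCotiZelati2017, §2] -/
theorem fluxKernelGrad_dissipProfile_eq_zero_of_one_lt {ε : ℝ} (hε : 1 < ε) (a : d) (z : UnitAddTorus d) :
    FunctionSpaces.Torus.fluxKernelGrad (FunctionSpaces.Torus.freqBall (d := d) ⌈ε⁻¹⌉₊)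
      (fun k => Real.dissipProfile (ε ^ 2 * FunctionSpaces.Torus.freqNormSq k)) a z = 0 := by
  unfold FunctionSpaces.Torus.fluxKernelGrad
  refine Finset.sum_eq_zero fun k _ => ?_
  by_cases hk : k = 0
  · subst hk
    simp
  · have h1 : 1 ≤ FunctionSpaces.Torus.freqNormSq k := FunctionSpaces.Torus.one_le_freqNormSq_of_ne_zero hk
    have h2 : 1 ≤ ε ^ 2 * FunctionSpaces.Torus.freqNormSq k := by nlinarith
    show Real.dissipProfile (ε ^ 2 * FunctionSpaces.Torus.freqNormSq k) * _ = 0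
    rw [Real.dissipProfile_eq_zero_of_le h2, zero_mul]

variable [Nonempty d]

/-- **THE WINDOW DISSIPATION FLOOR (forward and adjoint).**  See the module docstring. [cite: Temam1984, Ch. III §1 Lemma 1.2] -/
theorem exists_window_dissipation_const (d : Type*) [Fintype d] [DecidableEq d] [Nonempty d] :
    ∃ c₀ : ℝ, 0 < c₀ ∧ ∀ {T : ℝ} {𝔸 : Visc4 d} {lo hi : ℝ} {b : ℝ → UnitAddTorus d → EuclideanSpace ℝ d}
      {U : ℝ → ℝ → (Lp (EuclideanSpace ℝ d) 2 (volume : Measure (UnitAddTorus d)) →L[ℝ]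
        Lp (EuclideanSpace ℝ d) 2 (volume : Measure (UnitAddTorus d)))},
      IsPropagator T b 𝔸 U → NearIso 𝔸 lo hi → 0 < lo →
      MemLp (FunctionSpaces.Torus.stLift b) ⊤ (volume.restrict (Ioo 0 T ×ˢ univ)) →
      (∀ᵐ τ ∂(volume.restrict (Ioo 0 T)), FunctionSpaces.Torus.IsWeaklyDivFree (b τ)) →
      (∀ᵐ τ ∂(volume.restrict (Ioo 0 T)), Continuous (b τ)) →
      ∀ {L : ℝ}, 0 ≤ L →
      (∀ᵐ τ ∂(volume.restrict (Ioo 0 T)), ∀ x y, ‖b τ x - b τ y‖ ≤ L * ‖FunctionSpaces.Torus.reprc (x - y)‖) →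
      ∀ {s s' : ℝ}, 0 ≤ s → s < s' → s' ≤ T → L * (s' - s) ≤ c₀ →
      ∀ y : Lp (EuclideanSpace ℝ d) 2 (volume : Measure (UnitAddTorus d)),
        ‖U s s' y‖ ^ 2 ≤ ‖y‖ ^ 2 - 1 / 2 * ∑' k : d → ℤ,
            min 1 (8 * Real.pi ^ 2 * lo * FunctionSpaces.Torus.freqNormSq k * (s' - s)) *
              ‖mFourierCoeff (FunctionSpaces.EuclideanSpace.complexify ∘ (y : UnitAddTorus d → EuclideanSpace ℝ d)) k‖ ^ 2 ∧
        ‖ContinuousLinearMap.adjoint (U s s') y‖ ^ 2 ≤ ‖y‖ ^ 2 - 1 / 2 * ∑' k : d → ℤ,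
            min 1 (8 * Real.pi ^ 2 * lo * FunctionSpaces.Torus.freqNormSq k * (s' - s)) *
              ‖mFourierCoeff (FunctionSpaces.EuclideanSpace.complexify ∘ (y : UnitAddTorus d → EuclideanSpace ℝ d)) k‖ ^ 2 := by
  -- the kernel constant of the profile
  obtain ⟨C, hC0, hC⟩ := FunctionSpaces.Torus.exists_cube_moment_fluxKernelGrad_le (d := d) Real.dissipProfile
    Real.contDiff_dissipProfile (fun x hx => Real.dissipProfile_eq_zero_of_le hx)
  refine ⟨1 / (10 * Real.pi ^ 2 * (C + 1)), by positivity, ?_⟩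
  intro T 𝔸 lo hi b U hU h𝔸 hlo hb hbdiv hbc L hL0 hbL s s' hs hss' hs'T hwin y
  set τ : ℝ := s' - s with hτdef
  have hτ : 0 < τ := sub_pos.2 hss'
  -- the dissipation scale `ε² = 8π² lo τ`
  set ε : ℝ := Real.sqrt (8 * Real.pi ^ 2 * lo * τ) with hεdef
  have hε2 : ε ^ 2 = 8 * Real.pi ^ 2 * lo * τ := Real.sq_sqrt (by positivity)
  have hε : 0 < ε := Real.sqrt_pos.2 (by positivity)
  set F : Finset (d → ℤ) := FunctionSpaces.Torus.freqBall (d := d) ⌈ε⁻¹⌉₊ with hFdef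
  set wt : (d → ℤ) → ℝ := fun k => Real.dissipProfile (ε ^ 2 * FunctionSpaces.Torus.freqNormSq k) with hwtdef
  set x : (d → ℤ) → ℝ := fun k => 8 * Real.pi ^ 2 * lo * FunctionSpaces.Torus.freqNormSq k * τ with hxdef
  have hxε : ∀ k, ε ^ 2 * FunctionSpaces.Torus.freqNormSq k = x k := fun k => by rw [hε2, hxdef]; ring
  have hx0 : ∀ k, 0 ≤ x k := fun k => by
    rw [hxdef]; have := FunctionSpaces.Torus.freqNormSq_nonneg k; positivity
  have hωF : ∀ k, k ∉ F → wt k = 0 := fun k hk =>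
    FunctionSpaces.Torus.dissipWeight_eq_zero_of_not_mem_freqBall (Ψ := Real.dissipProfile)
      (fun x hx => Real.dissipProfile_eq_zero_of_le hx) hε hk
  have hω0 : ∀ k, 0 ≤ wt k := fun k => Real.dissipProfile_nonneg _
  have hω1 : ∀ k, wt k ≤ 1 := fun k => Real.dissipProfile_le_one (by rw [hxε]; exact hx0 k)
  have hωlo : ∀ k, Real.log 2 * (1 - wt k) ≤ 4 / 5 * (8 * Real.pi ^ 2 * lo * FunctionSpaces.Torus.freqNormSq k * (s' - s)) := by
    intro k
    have h := Real.log_two_mul_one_sub_dissipProfile_le (x := ε ^ 2 * FunctionSpaces.Torus.freqNormSq k) (by rw [hxε]; exact hx0 k)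
    calc Real.log 2 * (1 - wt k) = Real.log 2 * (1 - Real.dissipProfile (ε ^ 2 * FunctionSpaces.Torus.freqNormSq k)) := rfl
      _ ≤ 4 / 5 * (ε ^ 2 * FunctionSpaces.Torus.freqNormSq k) := h
      _ = 4 / 5 * x k := by rw [hxε]
      _ = 4 / 5 * (8 * Real.pi ^ 2 * lo * FunctionSpaces.Torus.freqNormSq k * (s' - s)) := rfl
  have hxω : ∀ k, min 1 (x k) ≤ 1 - wt k := by
    intro k
    have h := Real.dissipProfile_le_max (ε ^ 2 * FunctionSpaces.Torus.freqNormSq k)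
    rw [hxε] at h
    show min 1 (x k) ≤ 1 - Real.dissipProfile (ε ^ 2 * FunctionSpaces.Torus.freqNormSq k)
    rw [hxε]
    rcases le_total 0 (1 - x k) with h1 | h1
    · rw [max_eq_right h1] at h
      have : min 1 (x k) ≤ x k := min_le_right _ _
      linarith
    · rw [max_eq_left h1] at h
      have : min 1 (x k) ≤ 1 := min_le_left _ _
      linarith
  -- the flux condition
  have hM : L * (∫ z, ‖FunctionSpaces.Torus.reprc z‖ ^ 3 * ∑ a, |FunctionSpaces.Torus.fluxKernelGrad F wt a z|) ≤ 4 / 5 * lo := by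
    rcases le_or_gt ε 1 with hε1 | hε1
    · have h1 := hC ε hε hε1
      calc L * (∫ z, ‖FunctionSpaces.Torus.reprc z‖ ^ 3 * ∑ a, |FunctionSpaces.Torus.fluxKernelGrad F wt a z|)
          ≤ L * (C * ε ^ 2) := mul_le_mul_of_nonneg_left h1 hL0
        _ = 8 * Real.pi ^ 2 * lo * C * (L * τ) := by rw [hε2]; ring
        _ ≤ 8 * Real.pi ^ 2 * lo * C * (1 / (10 * Real.pi ^ 2 * (C + 1))) :=
            mul_le_mul_of_nonneg_left hwin (by positivity)
        _ ≤ 4 / 5 * lo := by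
            rw [show 8 * Real.pi ^ 2 * lo * C * (1 / (10 * Real.pi ^ 2 * (C + 1))) = 4 / 5 * lo * (C / (C + 1)) by
              field_simp; ring]
            have : C / (C + 1) ≤ 1 := (div_le_one (by linarith)).2 (by linarith)
            nlinarith
    · have h0 : (fun z : UnitAddTorus d => ‖FunctionSpaces.Torus.reprc z‖ ^ 3 *
          ∑ a, |FunctionSpaces.Torus.fluxKernelGrad F wt a z|) = fun _ => 0 := by
        funext z
        simp only [hFdef, hwtdef, fluxKernelGrad_dissipProfile_eq_zero_of_one_lt hε1, abs_zero, Finset.sum_const_zero, mul_zero]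
      rw [h0, integral_zero, mul_zero]
      positivity
  refine ⟨?_, ?_⟩
  · have h := hU.norm_sq_apply_le_sub_tsum h𝔸 hlo hb hbdiv hbc hL0 hbL hs hss' hs'T F wt hωF hω0 hω1 hωlo hM x hx0 hxω y
    simpa only [hxdef, hτdef] using h
  · have h := hU.norm_sq_adjoint_apply_le_sub_tsum h𝔸 hlo hb hbdiv hbc hL0 hbL hs hss' hs'T F wt hωF hω0 hω1 hωlo hM x hx0 hxω y
    simpa only [hxdef, hτdef] using h

end Torus

end Literature.Analysis.FluidPDE

end
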